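/-
Copyright: rh-split cell (nb, neg) gen 17, 2026-08-27.  Splitting search over kernel-typed
RH-equivalences.  A splitting `A ∧ B ⟹ RH` is CONDITIONAL bookkeeping unless `A` and `B` are both
proved; nothing here bears on the truth of RH.
-/
import Summits.RiemannHypothesis.RiemannHypothesis.Theorems.Splittings.NbOneShotA
import HarnessLib

/-!
# One-shot Nyman–Beurling certificates are decided RH-free (nb/neg V42) — part B

Continuation of `NbOneShotA` (same namespace `…Splittings.NbOneShot`; the module docstring of
`NbOneShotA` states the objects, the census row and the theorem map for all parts).  Content below is the
original one-file kernel VERBATIM (lines 387–619 of the uncarved file).  No `sorry`, no new axioms, no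
definitions, no instances, no notation.
-/

noncomputable section

set_option linter.dupNamespace false
open Complex Filter Topology Metric LSeries

namespace Summit.RiemannHypothesis.RiemannHypothesis.Theorems.Splittings.NbOneShot

open Summit.RiemannHypothesis.RiemannHypothesis.Theses.NymanBeurling
open Summit.RiemannHypothesis.RiemannHypothesis.Theorems
open Literature.NumberTheory.LFunctions
open Literature.Barriers.RiemannHypothesis

/-! ## §2′ — Hybrid universality: `ζ·A` attains EVERY non-zero value on every far sub-strip -/

/-- **`ζ·A` attains every non-zero value far up every sub-strip (nb/neg T43e; RH-free).**  For
`1/2 < σ₁ < σ₂ < 1`, every NON-ZERO Dirichlet polynomial `A(s) = Σ_{n<N} a_n (n+1)^{-s}`, every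
`c ≠ 0` and every height `T₀` there is `s` with `σ₁ < Re s < σ₂`, `Im s ≥ T₀` and `ζ(s)·A(s) = c`
EXACTLY.  Proof (the Kaczorowski–Kulas / Pańkowski Cor. 5.3 mechanism, for one character): pick
`σ₀ ∈ (σ₁, σ₂)` with `A(σ₀) ≠ 0` and a small disc `|s - σ₀| ≤ r` on which the target
`f = (c + (s - σ₀))/A` is analytic and zero-free; HYBRID joint universality (tree,
`Pankowski2010_thm1_1_discAnalytic_holds`, for `ζ = L(·, 𝟙 mod 1)` and the frequencies
`-log p / 2π`, `p ≤ N+2`, `ℤ`-independent by unique factorisation, tree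
`KroneckerWeyl.linearIndependent_neg_log_prime_div`) gives shifts `τ` of positive lower density with
`ζ(s+iτ) ≈ f(s)` on the disc AND all `p^{-iτ} ≈ 1`, hence `A(s+iτ) ≈ A(s)` and
`ζ(s+iτ)A(s+iτ) - c ≈ (s - σ₀)` within `r/2` on the disc; Rouché (tree `exists_zero_of_norm_sub_lt`)
gives a zero of `ζA - c` in the shifted disc.  This is the sharp form of §2: on every far sub-strip the
values of `ζ·A` omit NOTHING but possibly `0`.
[cite: Pankowski2010, Thm. 1.1 and Cor. 5.3 (proof)] [cite: KaczorowskiKulas2006, Thm. 2] -/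
theorem exists_zeta_mul_eq {N : ℕ} {a : Fin N → ℂ} (ha : a ≠ 0) {σ₁ σ₂ : ℝ} (h₁ : 1 / 2 < σ₁)
    (h₁₂ : σ₁ < σ₂) (h₂ : σ₂ < 1) {c : ℂ} (hc : c ≠ 0) (T₀ : ℝ) :
    ∃ s : ℂ, σ₁ < s.re ∧ s.re < σ₂ ∧ T₀ ≤ s.im ∧
      riemannZeta s * ∑ n : Fin N, a n * ((n : ℂ) + 1) ^ (-s) = c := by
  classical
  /- Step 0: the coefficient sequence `P` (`P (m+1) = a m`) and `A = LSeries P`. -/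
  set cf : ℕ → ℂ := fun m => if hm : m < N then a ⟨m, hm⟩ else 0 with hcf
  set P : ℕ → ℂ := fun k => if 1 ≤ k ∧ k ≤ N then cf (k - 1) else 0 with hPdef
  have hsupp : (Function.support P).Finite := by
    refine (Set.finite_Iic N).subset fun k hk => ?_
    rw [Function.mem_support] at hk
    by_contra hkN
    exact hk (if_neg fun hh => hkN (Set.mem_Iic.mpr hh.2))
  have hA : ∀ w : ℂ, LSeries P w = ∑ n : Fin N, a n * ((n : ℂ) + 1) ^ (-w) := by
    intro w
    rw [LSeries_shift_eq_sum_range N cf w,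
      ← Fin.sum_univ_eq_sum_range (fun m => cf m * ((m : ℂ) + 1) ^ (-w)) N]
    refine Finset.sum_congr rfl fun n _ => ?_
    simp only [hcf, dif_pos n.isLt]
  have hPne : ∃ k, k ≠ 0 ∧ P k ≠ 0 := by
    obtain ⟨n, hn⟩ := Function.ne_iff.mp ha
    refine ⟨(n : ℕ) + 1, Nat.succ_ne_zero _, ?_⟩
    have h1 : 1 ≤ (n : ℕ) + 1 ∧ (n : ℕ) + 1 ≤ N := ⟨by omega, by omega⟩
    simp only [hPdef, h1, and_self, if_true, Nat.add_sub_cancel, hcf, dif_pos n.isLt, Fin.eta]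
    simpa using hn
  have hAne : LSeries P ≠ 0 := FiniteLSeries.ne_zero hsupp hPne
  have hAan : AnalyticOnNhd ℂ (LSeries P) Set.univ := fun s _ => FiniteLSeries.analyticAt hsupp s
  /- Step 1: a centre `σ₀ ∈ (σ₁, σ₂)` with `A(σ₀) ≠ 0`. -/
  obtain ⟨σ₀, hσ₁, hσ₂, hAσ₀, -⟩ := exists_mem_Ioo_ne_zero_and_ne_zero hAan hAan hAne hAne h₁₂
  /- Step 2: the target `f = (c + (s - σ₀)) / A` on a small disc. -/
  set f : ℂ → ℂ := fun s => (c + (s - σ₀)) / LSeries P s with hfdef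
  have hfσ₀ : f σ₀ ≠ 0 := by
    simp only [hfdef, sub_self, add_zero]
    exact div_ne_zero hc hAσ₀
  have hfdiff : ∀ s, LSeries P s ≠ 0 → DifferentiableAt ℂ f s := fun s hs =>
    ((differentiableAt_const _).add (differentiableAt_id.sub (differentiableAt_const _))).div
      (FiniteLSeries.differentiable hsupp s) hs
  have hev : ∀ᶠ s in 𝓝 (σ₀ : ℂ), LSeries P s ≠ 0 ∧ f s ≠ 0 :=
    ((FiniteLSeries.continuous hsupp).continuousAt.eventually_ne hAσ₀).and
      ((hfdiff _ hAσ₀).continuousAt.eventually_ne hfσ₀)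
  obtain ⟨ρ, hρ, hball⟩ := Metric.eventually_nhds_iff_ball.1 hev
  have hgap : 0 < min (σ₀ - σ₁) (σ₂ - σ₀) := lt_min (sub_pos.2 hσ₁) (sub_pos.2 hσ₂)
  set r : ℝ := min (ρ / 2) (min (σ₀ - σ₁) (σ₂ - σ₀) / 2) with hr
  have hr0 : 0 < r := lt_min (half_pos hρ) (half_pos hgap)
  have hrρ : r < ρ := (min_le_left _ _).trans_lt (half_lt_self hρ)
  have hr₁ : σ₁ < σ₀ - r := by
    have : r ≤ (σ₀ - σ₁) / 2 :=
      (min_le_right _ _).trans (div_le_div_of_nonneg_right (min_le_left _ _) zero_le_two)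
    linarith
  have hr₂ : σ₀ + r < σ₂ := by
    have : r ≤ (σ₂ - σ₀) / 2 :=
      (min_le_right _ _).trans (div_le_div_of_nonneg_right (min_le_right _ _) zero_le_two)
    linarith
  have h_half : 1 / 2 < σ₀ - r := h₁.trans hr₁
  have h_one : σ₀ + r < 1 := hr₂.trans h₂
  have hK : ∀ s ∈ closedBall (σ₀ : ℂ) r, LSeries P s ≠ 0 ∧ f s ≠ 0 := fun s hs =>
    hball s (closedBall_subset_ball hrρ hs)
  have hre : ∀ z ∈ closedBall (σ₀ : ℂ) r, σ₀ - r ≤ z.re ∧ z.re ≤ σ₀ + r := by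
    intro z hz
    have h := (abs_re_le_norm (z - σ₀)).trans (mem_closedBall_iff_norm.1 hz)
    rw [sub_re, ofReal_re] at h
    constructor <;> linarith [(abs_le.1 h).1, (abs_le.1 h).2]
  have hfd : DifferentiableOn ℂ f (ball (σ₀ : ℂ) ρ) := fun s hs =>
    (hfdiff s (hball s hs).1).differentiableWithinAt
  have hfc : ContinuousOn f (closedBall (σ₀ : ℂ) r) :=
    hfd.continuousOn.mono (closedBall_subset_ball hrρ)
  have hf0 : ∀ s ∈ closedBall (σ₀ : ℂ) r, f s ≠ 0 := fun s hs => (hK s hs).2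
  have htarget : ∀ s ∈ closedBall (σ₀ : ℂ) r, LSeries P s * f s = c + (s - σ₀) := by
    intro s hs
    have hAs := (hK s hs).1
    simp only [hfdef]
    field_simp
  /- Step 3: constants. -/
  set B : ℝ := ∑ n ∈ hsupp.toFinset, ‖P n‖ with hB
  set B' : ℝ := ∑ n ∈ hsupp.toFinset with n ≠ 0, ‖P n‖ * n with hB'
  have hB0 : 0 ≤ B := Finset.sum_nonneg fun n _ => norm_nonneg _
  have hB'0 : 0 ≤ B' := Finset.sum_nonneg fun n _ => by positivity
  obtain ⟨M, hM⟩ := (isCompact_closedBall (σ₀ : ℂ) r).exists_bound_of_continuousOn hfc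
  set Mf : ℝ := |M| with hMf
  have hMf0 : 0 ≤ Mf := abs_nonneg _
  have hfM : ∀ s ∈ closedBall (σ₀ : ℂ) r, ‖f s‖ ≤ Mf := fun s hs =>
    (hM s hs).trans (le_abs_self _)
  set C : ℝ := B + 2 * Real.pi * B' * Mf with hC
  have hC0 : 0 ≤ C := by positivity
  set ε : ℝ := r / (2 * (C + 1)) with hε
  have hε0 : 0 < ε := by positivity
  have hεC : ε * C < r / 2 := by
    rw [hε, div_mul_eq_mul_div, div_lt_div_iff₀ (by positivity) two_pos]
    nlinarith
  /- Step 4: the support bound `Q = N + 2` and the frequencies `-log p / 2π`, `p ≤ Q` prime. -/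
  set Q : ℕ := N + 2 with hQ
  have hnQ : ∀ n ∈ hsupp.toFinset, n ≤ Q := by
    intro n hn
    rw [Set.Finite.mem_toFinset, Function.mem_support] at hn
    by_contra hlt
    exact hn (if_neg fun hh => hlt (by omega))
  haveI : Nonempty ↥(Nat.primesBelow (Q + 1)) :=
    ⟨⟨2, Nat.mem_primesBelow.2 ⟨by omega, Nat.prime_two⟩⟩⟩
  have hαli : LinearIndependent ℚ
      (fun p : ↥(Nat.primesBelow (Q + 1)) => -Real.log (p : ℕ) / (2 * Real.pi)) :=
    (LinearIndependent.iff_fractionRing ℤ ℚ).1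
      (Literature.NumberTheory.DiophantineApproximation.KroneckerWeyl.linearIndependent_neg_log_prime_div
        _ fun p hp => Nat.prime_of_mem_primesBelow hp)
  /- Step 5: hybrid joint universality for `ζ = L(·, 𝟙 mod 1)` on `|s - σ₀| ≤ r`, phases `0`. -/
  have hD : HasPosLowerDensity {τ : ℝ |
      (∀ _i : Unit, ∀ s ∈ closedBall (σ₀ : ℂ) r,
        ‖(1 : DirichletCharacter ℂ 1).LFunction (s + τ * I) - f s‖ < ε) ∧
      ∀ k : ↥(Nat.primesBelow (Q + 1)), ∃ m : ℤ,
        |τ * (-Real.log ((k : ℕ) : ℝ) / (2 * Real.pi)) - 0 - m| < ε} :=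
    Pankowski2010_thm1_1_discAnalytic_holds Unit (fun _ => 1)
      (fun _ => (1 : DirichletCharacter ℂ 1)) Subsingleton.pairwise (σ₀ : ℂ) r ρ hr0 hrρ
      (by rwa [ofReal_re]) (by rwa [ofReal_re]) (fun _ => f) (fun _ => hfd) (fun _ => hf0) _
      (fun p : ↥(Nat.primesBelow (Q + 1)) => -Real.log (p : ℕ) / (2 * Real.pi)) hαli
      (fun _ => (0 : ℝ)) ε hε0
  obtain ⟨τ, ⟨hτL, hτD⟩, hτT⟩ := hD.exists_gt (|T₀| + r)
  /- Step 6: phases of the primes `p ≤ Q`, then of all `n ≤ Q`. -/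
  have hphase : ∀ p : ℕ, p.Prime → p ≤ Q →
      ‖(p : ℂ) ^ (((-τ : ℝ) : ℂ) * I) - 1‖ ≤ 2 * Real.pi * ε := by
    intro p hp hpQ
    obtain ⟨m, hm⟩ := hτD ⟨p, Nat.mem_primesBelow.2 ⟨Nat.lt_succ_of_le hpQ, hp⟩⟩
    have hm' : |τ * (-Real.log p / (2 * Real.pi)) - m| < ε := by
      simpa only [sub_zero] using hm
    exact (norm_natCast_cpow_neg_mul_I_sub_one_le_two_pi hp.ne_zero τ m).trans
      (mul_le_mul_of_nonneg_left hm'.le (by positivity))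
  have hnphase := norm_natCast_cpow_mul_I_sub_one_le (u := -τ)
    (by positivity : (0 : ℝ) ≤ 2 * Real.pi * ε) hphase
  /- Step 7: the main estimate `‖ζ(z+iτ)A(z+iτ) - c - (z - σ₀)‖ < r/2` on the closed disc. -/
  set g : ℂ → ℂ := fun z => riemannZeta (z + τ * I) * LSeries P (z + τ * I) - c with hgdef
  have hclose : ∀ z ∈ closedBall (σ₀ : ℂ) r, ‖g z - (z - σ₀)‖ < r / 2 := by
    intro z hz
    have hz0 : 0 ≤ z.re := by linarith [(hre z hz).1]
    have hzτ0 : 0 ≤ (z + τ * I).re := by simpa using hz0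
    have e1 : g z - (z - σ₀) =
        LSeries P (z + τ * I) * (riemannZeta (z + τ * I) - f z) +
          (LSeries P (z + τ * I) - LSeries P z) * f z := by
      have ht := htarget z hz
      simp only [hgdef]
      linear_combination ht
    rw [e1]
    have hLz : ‖riemannZeta (z + τ * I) - f z‖ < ε := by
      have h := hτL () z hz
      rwa [DirichletCharacter.LFunction_modOne_eq] at h
    have hshift : ‖LSeries P (z + τ * I) - LSeries P z‖ ≤ 2 * Real.pi * ε * B' := by
      refine (FiniteLSeries.norm_shift_sub_le hsupp hz0 τ).trans ?_
      rw [hB', Finset.mul_sum]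
      refine Finset.sum_le_sum fun n hn => ?_
      obtain ⟨hn1, hn2⟩ := Finset.mem_filter.1 hn
      calc ‖P n‖ * ‖(n : ℂ) ^ (((-τ : ℝ) : ℂ) * I) - 1‖
          ≤ ‖P n‖ * (n * (2 * Real.pi * ε)) :=
            mul_le_mul_of_nonneg_left (hnphase n hn2 (hnQ n hn1)) (norm_nonneg _)
        _ = 2 * Real.pi * ε * (‖P n‖ * n) := by ring
    calc ‖LSeries P (z + τ * I) * (riemannZeta (z + τ * I) - f z) +
            (LSeries P (z + τ * I) - LSeries P z) * f z‖
        ≤ ‖LSeries P (z + τ * I) * (riemannZeta (z + τ * I) - f z)‖ +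
            ‖(LSeries P (z + τ * I) - LSeries P z) * f z‖ := norm_add_le _ _
      _ ≤ B * ε + 2 * Real.pi * ε * B' * Mf := by
          rw [norm_mul, norm_mul]
          exact add_le_add
            (mul_le_mul (FiniteLSeries.norm_le hsupp hzτ0) hLz.le (norm_nonneg _) hB0)
            (mul_le_mul hshift (hfM z hz) (norm_nonneg _) (by positivity))
      _ = ε * C := by rw [hC]; ring
      _ < r / 2 := hεC
  /- Step 8: Rouché on `|z - σ₀| < r` against `z - σ₀`. -/
  have hgd : DiffContOnCl ℂ g (ball (σ₀ : ℂ) r) := by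
    refine DifferentiableOn.diffContOnCl fun z hz => DifferentiableAt.differentiableWithinAt ?_
    rw [closure_ball _ hr0.ne'] at hz
    have hz1 : z + τ * I ≠ 1 := by
      intro h
      have h2 := congrArg Complex.re h
      simp only [add_re, mul_re, ofReal_re, I_re, mul_zero, ofReal_im, I_im, mul_one, sub_self,
        add_zero, one_re] at h2
      linarith [(hre z hz).2]
    have hlin : DifferentiableAt ℂ (fun s : ℂ => s + τ * I) z := differentiableAt_id.add_const _
    have hζ' : DifferentiableAt ℂ (fun s : ℂ => riemannZeta (s + τ * I)) z :=
      (differentiableAt_riemannZeta hz1).comp z hlin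
    have hA' : DifferentiableAt ℂ (fun s : ℂ => LSeries P (s + τ * I)) z :=
      (FiniteLSeries.differentiable hsupp _).comp z hlin
    exact (hζ'.mul hA').sub_const c
  obtain ⟨z, hz, hz0⟩ := exists_zero_of_norm_sub_lt (f := fun s => s - σ₀) (g := g) hr0 hgd
    (sub_self _) (fun w hw => (mem_sphere_iff_norm.1 hw).ge) hclose
  have hzre := (abs_re_le_norm (z - σ₀)).trans_lt (mem_ball_iff_norm.1 hz)
  have hzim := (abs_im_le_norm (z - σ₀)).trans_lt (mem_ball_iff_norm.1 hz)
  rw [sub_re, ofReal_re] at hzre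
  rw [sub_im, ofReal_im, sub_zero] at hzim
  have e_re : (z + τ * I).re = z.re := by simp
  have e_im : (z + τ * I).im = z.im + τ := by simp
  refine ⟨z + τ * I, ?_, ?_, ?_, ?_⟩
  · rw [e_re]; linarith [(abs_lt.1 hzre).1]
  · rw [e_re]; linarith [(abs_lt.1 hzre).2]
  · rw [e_im]; linarith [(abs_lt.1 hzim).1, le_abs_self T₀]
  · have h0 : riemannZeta (z + τ * I) * LSeries P (z + τ * I) - c = 0 := hz0
    rw [← hA]
    exact sub_eq_zero.mp h0

/-- **The Nyman–Beurling defect `1 - ζA` attains EVERY value `v ≠ 1` far up every sub-strip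
(nb/neg T43e′; RH-free)**: for `1/2 < σ₁ < σ₂ < 1`, `a ≠ 0`, `v ≠ 1` and `T₀` there is `s` with
`σ₁ < Re s < σ₂`, `Im s ≥ T₀`, `1 - ζ(s)A(s) = v` — so the defect's values on every far sub-strip
are dense in `ℂ` (indeed all of `ℂ ∖ {1}`, and `1` too iff `ζA` vanishes there).
[cite: Pankowski2010, Thm. 1.1] -/
theorem exists_one_sub_zeta_mul_eq {N : ℕ} {a : Fin N → ℂ} (ha : a ≠ 0) {σ₁ σ₂ : ℝ}
    (h₁ : 1 / 2 < σ₁) (h₁₂ : σ₁ < σ₂) (h₂ : σ₂ < 1) {v : ℂ} (hv : v ≠ 1) (T₀ : ℝ) :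
    ∃ s : ℂ, σ₁ < s.re ∧ s.re < σ₂ ∧ T₀ ≤ s.im ∧
      1 - riemannZeta s * ∑ n : Fin N, a n * ((n : ℂ) + 1) ^ (-s) = v := by
  obtain ⟨s, hs₁, hs₂, hs₃, h⟩ :=
    exists_zeta_mul_eq ha h₁ h₁₂ h₂ (c := 1 - v) (sub_ne_zero.mpr hv.symm) T₀
  exact ⟨s, hs₁, hs₂, hs₃, by rw [h]; ring⟩

/-- **Perfect mollification points (nb/neg T43e″; RH-free).**  For every NON-ZERO Dirichlet
polynomial `A` and every far part of every sub-strip `1/2 < σ₁ < Re s < σ₂ < 1` there is a point with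
`ζ(s)·A(s) = 1` EXACTLY — the NB defect vanishes at single points for every `A ≢ 0`, while (§2, §3)
no `A` makes it `< 1` on a whole strip. [cite: Pankowski2010, Thm. 1.1] -/
theorem exists_zeta_mul_eq_one {N : ℕ} {a : Fin N → ℂ} (ha : a ≠ 0) {σ₁ σ₂ : ℝ}
    (h₁ : 1 / 2 < σ₁) (h₁₂ : σ₁ < σ₂) (h₂ : σ₂ < 1) (T₀ : ℝ) :
    ∃ s : ℂ, σ₁ < s.re ∧ s.re < σ₂ ∧ T₀ ≤ s.im ∧
      riemannZeta s * ∑ n : Fin N, a n * ((n : ℂ) + 1) ^ (-s) = 1 :=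
  exists_zeta_mul_eq ha h₁ h₁₂ h₂ one_ne_zero T₀


end Summit.RiemannHypothesis.RiemannHypothesis.Theorems.Splittings.NbOneShot

end
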